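import Mathlib.GroupTheory.Index
import Mathlib.GroupTheory.SpecificGroups.Dihedral
import Summits.MatrixMultiplication.OmegaCensus.BoxRatioSectionLaw
import Summits.MatrixMultiplication.OmegaCensus.DihC3SqDih

/-!
# ω-census, family (b3): conjecture C9 — box-USELESSNESS lifts along surjections; `D₁₀` (ratio `9/5` exactly) as the first kernel BAD group

HONEST FRAMING (pub-omega census; verbatim): lottery ticket; floor = certified bounds/negative ranges.
Census BOOKKEEPING (conjecture C9 of the cell; pub-omega stpp-1 gen 17): the '(a)-FORCED' mechanism of the cell's C9 tests
(prereg P-035: a row is forced to box ratio `≥ 9/5` by a BAD section) in the kernel, quotient half, witness form: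
* `not_boxUseful_of_indep` — a `3 × 3` box with an independent cell set `J`, `9|G| ≤ 5|J|`, makes `G` NOT box-useful
  (`BoxUseful`, `BoxRatioSectionLaw.lean`: usefulness demands `5|I| < 9|G|` for every such `I`);
* `exists_indep_of_surjective` — an independent `3 × 3`-box cell set of a quotient `Q` (any surjection `f : G →* Q`) gives
  one of `G` with `|J|·|Q| = |I|·|G|` (`DihC3Sq.exists_indep_lift` + `|ker f|·|Q| = |G|`), so `not_boxUseful_of_surjective`:
  a box-useless witness downstairs makes every group upstairs useless;
* `D5_exists_indep_18` — the engine's exact value `α(D₁₀; 10, 3, 3) = 18 = (9/5)·10` (cell calibration constant 'D10 = 18';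
  boxmis2 9b0cf7fc), lower side, as an explicit `18`-cell independent set of the box `Y = {1, r, r²}`, `W = {1, r², s}` of
  `DihedralGroup 5`, checked by `decide`; hence `not_boxUseful_dihedral5` and **`not_boxUseful_of_surjective_dihedral5`: no
  finite group with a `D₁₀` quotient is box-useful** — the kernel form of 'forced by a D₁₀ quotient' (P-035 rows D₃₀-type,
  `F₂₀`, `C₅ ⋊ C₄`, …, once their surjection is exhibited).
Nothing here is progress on `ω`.
-/

namespace Summit.MatrixMultiplication.OmegaCensus

open Finset ProductBoxBound

variable {G : Type*} [Group G] [Fintype G] [DecidableEq G]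

/-- A `3 × 3` box with an independent cell set of at least `(9/5)|G|` cells makes `G` box-useless. [folklore] -/
theorem not_boxUseful_of_indep {Y W : Finset G} (hY : #Y = 3) (hW : #W = 3) {J : Finset (G × G × G)}
    (hJ : J ⊆ univ ×ˢ (Y ×ˢ W)) (hind : ∀ P ∈ J, ∀ P' ∈ J, P ≠ P' → cellWord P P' ≠ 1)
    (hbig : 9 * Fintype.card G ≤ 5 * #J) : ¬ BoxUseful G := fun hG => by
  have := hG Y W hY hW J hJ hind
  omega

/-- **Independent cell sets lift from a quotient with the right count**: along a surjection `f : G →* Q`, an independent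
`3 × 3`-box cell set `I` of `Q` gives one `J` of `G` with `|J|·|Q| = |I|·|G|`. [folklore] -/
theorem exists_indep_of_surjective {Q : Type*} [Group Q] [Fintype Q] [DecidableEq Q] (f : G →* Q)
    (hf : Function.Surjective f) {Y W : Finset Q} {I : Finset (Q × Q × Q)} (hI : I ⊆ univ ×ˢ (Y ×ˢ W))
    (hind : ∀ P ∈ I, ∀ P' ∈ I, P ≠ P' → cellWord P P' ≠ 1) :
    ∃ (Y' W' : Finset G) (J : Finset (G × G × G)), #Y' = #Y ∧ #W' = #W ∧ J ⊆ univ ×ˢ (Y' ×ˢ W') ∧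
      (∀ P ∈ J, ∀ P' ∈ J, P ≠ P' → cellWord P P' ≠ 1) ∧ #J * Fintype.card Q = #I * Fintype.card G := by
  obtain ⟨Y', W', J, hY', hW', hJ, hJind, hJcard⟩ := DihC3Sq.exists_indep_lift f hf hI hind
  refine ⟨Y', W', J, hY', hW', hJ, hJind, ?_⟩
  have hidx : f.ker.index = Fintype.card Q := by
    rw [Subgroup.index_ker, MonoidHom.range_eq_top_of_surjective _ hf, Subgroup.card_top, Nat.card_eq_fintype_card]
  have hk : Nat.card f.ker * Fintype.card Q = Fintype.card G := by
    rw [← hidx, Subgroup.card_mul_index, Nat.card_eq_fintype_card]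
  rw [hJcard, mul_assoc, hk]

/-- **Box-uselessness lifts along surjections.** If a quotient `Q` of `G` has a `3 × 3` box with an independent cell set of at
least `(9/5)|Q|` cells, then `G` is not box-useful. [folklore] -/
theorem not_boxUseful_of_surjective {Q : Type*} [Group Q] [Fintype Q] [DecidableEq Q] (f : G →* Q)
    (hf : Function.Surjective f) {Y W : Finset Q} (hY : #Y = 3) (hW : #W = 3) {I : Finset (Q × Q × Q)}
    (hI : I ⊆ univ ×ˢ (Y ×ˢ W)) (hind : ∀ P ∈ I, ∀ P' ∈ I, P ≠ P' → cellWord P P' ≠ 1)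
    (hbig : 9 * Fintype.card Q ≤ 5 * #I) : ¬ BoxUseful G := by
  obtain ⟨Y', W', J, hY', hW', hJ, hJind, hJcard⟩ := exists_indep_of_surjective f hf hI hind
  refine not_boxUseful_of_indep (hY'.trans hY) (hW'.trans hW) hJ hJind ?_
  have hQ : 0 < Fintype.card Q := Fintype.card_pos
  nlinarith [hJcard, hbig, hQ]

/-! ### `D₁₀ = DihedralGroup 5`: `α(D₁₀; 10, 3, 3) ≥ 18 = (9/5)·10` -/

/-- The engine's `18`-cell witness of `D₁₀` in the box `Y = {1, r, r²}`, `W = {1, r², s}` (as a list). [folklore] -/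
def d5WitnessL : List (DihedralGroup 5 × DihedralGroup 5 × DihedralGroup 5) :=
  [(.r 0, .r 0, .sr 0), (.r 0, .r 1, .r 2), (.r 1, .r 1, .sr 0), (.r 1, .r 2, .r 2), (.r 2, .r 0, .r 0), (.r 2, .r 2, .sr 0),
    (.r 3, .r 1, .r 0), (.r 4, .r 0, .r 2), (.r 4, .r 2, .sr 0), (.sr 0, .r 0, .sr 0), (.sr 0, .r 1, .r 2), (.sr 1, .r 0, .r 2),
    (.sr 1, .r 2, .sr 0), (.sr 2, .r 1, .r 0), (.sr 2, .r 1, .sr 0), (.sr 3, .r 0, .r 0), (.sr 3, .r 0, .sr 0), (.sr 4, .r 2, .r 2)]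

/-- **`α(D₁₀; 10, 3, 3) ≥ 18`**: an independent `18`-cell set of a `3 × 3` box of `DihedralGroup 5` (kernel-checked; the
engine's exact value is `18`). [folklore] -/
theorem D5_exists_indep_18 :
    ∃ (Y W : Finset (DihedralGroup 5)) (I : Finset (DihedralGroup 5 × DihedralGroup 5 × DihedralGroup 5)),
      #Y = 3 ∧ #W = 3 ∧ I ⊆ univ ×ˢ (Y ×ˢ W) ∧ (∀ P ∈ I, ∀ P' ∈ I, P ≠ P' → cellWord P P' ≠ 1) ∧ #I = 18 :=
  ⟨{.r 0, .r 1, .r 2}, {.r 0, .r 2, .sr 0}, d5WitnessL.toFinset, by decide, by decide,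
    DihC3Sq.subset_box_of_inBoxB (by decide), DihC3Sq.indep_of_indepB (by decide), by decide⟩

/-- **`D₁₀` is not box-useful** (`5·18 = 9·10`). [folklore] -/
theorem not_boxUseful_dihedral5 : ¬ BoxUseful (DihedralGroup 5) := by
  obtain ⟨Y, W, I, hY, hW, hI, hind, hcard⟩ := D5_exists_indep_18
  exact not_boxUseful_of_indep hY hW hI hind (by rw [hcard, DihedralGroup.card])

/-- **No finite group with a `D₁₀` quotient is box-useful** (the kernel form of '(a)-forced by a `D₁₀` quotient'). [folklore] -/
theorem not_boxUseful_of_surjective_dihedral5 (f : G →* DihedralGroup 5) (hf : Function.Surjective f) : ¬ BoxUseful G := by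
  obtain ⟨Y, W, I, hY, hW, hI, hind, hcard⟩ := D5_exists_indep_18
  exact not_boxUseful_of_surjective f hf hY hW hI hind (by rw [hcard, DihedralGroup.card])

end Summit.MatrixMultiplication.OmegaCensus
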